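import Literature.NumberTheory.EllipticCurves.SerreOpenImageReductionInertiaProofs
import Literature.NumberTheory.EllipticCurves.SerreOpenImageOrdinaryReductionProofs
import Literature.NumberTheory.EllipticCurves.SerreOpenImageOrdinaryLineProofs
import Literature.NumberTheory.EllipticCurves.SerreOpenImageOfLocalInputProofs
import Literature.NumberTheory.EllipticCurves.LFunctionPrimeCoeff
import Literature.NumberTheory.GaloisRepresentations.DegreeOnePrimesFixedField
import HarnessLib

/-!
# Serre's open image theorem over `ℚ`: the ordinary half of the local input, discharged

Topic `NumberTheory/EllipticCurves`.  Theorems only (nothing is defined, no named fact).  J.-P.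
Serre, Invent. Math. 15 (1972), §4.2, Théorème 2 over `K = ℚ` is the tree's named fact
`Literature.NumberTheory.EllipticCurves.serre_open_image`; the tree theorem
`serre_open_image_of_reduction_shape` (`SerreOpenImageOfLocalInputProofs`) reduces it to the
density statement `WeierstrassCurve.serre_supersingular_density_zero` and to Serre's local
description (§1.11) of `E[ℓ]` under an inertia group `I_𝔏 ≤ Γ_ℚ` at a prime `ℓ` of good
reduction: either (ordinary case, Prop. 11 and its Corollary) `τ x - x ∈ 𝔽_ℓ v₀` for a fixed
line `𝔽_ℓ v₀ = X_ℓ`, or (supersingular case, Prop. 12 c)) the image of `I_𝔏` is cyclic of order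
`ℓ² - 1`.

This file **proves the ordinary alternative**
(`exists_line_of_not_dvd_frobeniusTrace_of_mem_primesAbove`):
for `E/ℚ` minimal, `ℓ ∤ Δ_E`, `ℓ ∤ a_ℓ` and every prime `𝔏` of `\bar ℤ` above `ℓ` there is
`v₀ ≠ 0` in `E[ℓ]` with `τ • x - x ∈ 𝔽_ℓ v₀` for all `τ ∈ I_𝔏`, `x ∈ E[ℓ]` — Serre, §1.11,
Cor. of Prop. 11 ("l'image de `I_p` dans `Aut(E_p)` est … contenue dans un sous-groupe de Borel",
indeed in the matrices `(χ *; 0 1)` since `χ_Y = 1`).  Serre reads it off the exact sequence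
`0 → X_ℓ → E_ℓ → Ẽ_ℓ → 0` of the formal group; here it is assembled from three tree theorems:
the reduction map `red : E(ℚ̄) → Ẽ(𝔽̄_ℓ)` along the place over `ℓ` is invariant under the
inertia group of the place's prime (`geomReduction_smul_of_mem_inertia`,
`SerreOpenImageReductionInertiaProofs`), it is nonzero on `E[ℓ]` at an ordinary prime
(`exists_zsmul_eq_zero_geomReduction_ne_zero`, `SerreOpenImageOrdinaryReductionProofs`), and
the counting skeleton `exists_forall_sub_mem_line_of_invariant` (`SerreOpenImageOrdinaryLineProofs`:
`#E[ℓ] = ℓ²` and `red|E[ℓ] ≠ 0` force `#ker ≤ ℓ`, a line containing all `τ x - x`); the other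
primes `𝔏` above `ℓ` are conjugate to the place's prime under `Γ_ℚ`
(`exists_smul_eq_of_mem_primesAbove_holds`), and the statement is covariant.

Consequently (`serre_open_image_of_supersingular_inertia_shape`) **Serre's theorem over `ℚ`
follows from the density fact and Prop. 12 c) at the good supersingular primes alone**
(`ℓ ∣ a_ℓ`: the image of `I_𝔏` in `Aut(E[ℓ])` is cyclic of order `ℓ² - 1`).

Also recorded: good reduction at `p` of a globally minimal equation means `p ∤ Δ_min`
(a light-import copy of the tree's `not_dvd_minimalDiscriminantInt_of_hasGoodReductionAtPrime`).

## References

* [Serre1972] J.-P. Serre, Invent. Math. 15 (1972) 259–331: §1.11 (Prop. 11, Cor.; Prop. 12),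
  §4.2 Théorème 2 and its proof.
* [SilvermanAEC2009] J. H. Silverman, *The Arithmetic of Elliptic Curves*, 2nd ed. (2009),
  VII.2–VII.3, VII.5.1.
-/

noncomputable section

open scoped Classical NumberField Pointwise
open IsDedekindDomain Field

namespace WeierstrassCurve

section GoodReduction

open NumberField Rat.HeightOneSpectrum Literature.NumberTheory.EllipticCurves

/-- **Good reduction at `p` of a globally minimal equation means `p ∤ Δ_min`.** `W ⊗ ℚ_p` is a
minimal equation at `p` (global minimality at the place `v` over `p`, transported along
`ℚ_v ≃ ℚ_p`), so it has good reduction together with Mathlib's chosen minimal model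
(AEC VII.1.3(b)), i.e. `v_p(Δ_W) = 0`.  (A light-import copy of the tree's
`WeierstrassCurve.not_dvd_minimalDiscriminantInt_of_hasGoodReductionAtPrime`, which lives in
`PAdicGrossZagierConstantTermProofs` behind the modularity/Gross–Zagier import closure.)
[cite: SilvermanAEC2009, VII.5 Prop. 5.1(a) and VII.1 Prop. 1.3(b)] -/
theorem not_dvd_minimalDiscriminantInt_of_hasGoodReductionAtPrime' (W : WeierstrassCurve ℚ)
    [W.IsGloballyMinimal] (p : ℕ) [Fact p.Prime] (h : W.HasGoodReductionAtPrime p) :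
    ¬ (p : ℤ) ∣ minimalDiscriminantInt W := by
  obtain ⟨v, hv⟩ : ∃ v : HeightOneSpectrum (𝓞 ℚ), (primesEquiv v : ℕ) = p :=
    ⟨primesEquiv.symm ⟨p, Fact.out⟩, by rw [Equiv.apply_symm_apply]⟩
  subst hv
  have he := padicEquiv_mem_range_iff_ringOfIntegers v
  -- `e` maps `W / ℚ_v` to `W / ℚ_[p]`
  have hW : (W.baseChange (v.adicCompletion ℚ)).map
      ((adicCompletion.padicEquiv v).toAlgEquiv.toRingEquiv :
        v.adicCompletion ℚ →+* ℚ_[(primesEquiv v : ℕ)]) = W.baseChange ℚ_[(primesEquiv v : ℕ)] := by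
    simp only [baseChange, map_map]
    exact congrArg W.map (Subsingleton.elim _ _)
  -- `W ⊗ ℚ_p` is a minimal equation
  haveI hmin : (W.baseChange ℚ_[(primesEquiv v : ℕ)]).IsMinimal ℤ_[(primesEquiv v : ℕ)] := by
    rw [← hW]
    exact (isMinimal_map_iff _ he _).mpr (IsGloballyMinimal.isMinimal v)
  -- so it has good reduction together with the chosen minimal model
  obtain ⟨D, hD⟩ : ∃ D : VariableChange ℚ_[(primesEquiv v : ℕ)],
      (W.baseChange ℚ_[(primesEquiv v : ℕ)]).minimal ℤ_[(primesEquiv v : ℕ)] =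
        D • W.baseChange ℚ_[(primesEquiv v : ℕ)] := ⟨_, rfl⟩
  have hgood : (W.baseChange ℚ_[(primesEquiv v : ℕ)]).HasGoodReduction ℤ_[(primesEquiv v : ℕ)] :=
    (hasGoodReduction_iff_of_isMinimal_of_eq_smul ℤ_[(primesEquiv v : ℕ)] hD).mp h
  -- read off `v(Δ) = 1` on the integral model `integralModelInt W ⊗ ℤ_p`
  set Mp : WeierstrassCurve ℤ_[(primesEquiv v : ℕ)] :=
    (integralModelInt W).map (Int.castRingHom ℤ_[(primesEquiv v : ℕ)]) with hMp
  have hWM : W.baseChange ℚ_[(primesEquiv v : ℕ)] = Mp.baseChange ℚ_[(primesEquiv v : ℕ)] := by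
    conv_lhs => rw [← map_integralModelInt W]
    rw [baseChange, baseChange, map_map, hMp, map_map]
    congr 1
  have hΔ := hgood.goodReduction
  rw [hWM, baseChange, map_Δ, IsDedekindDomain.HeightOneSpectrum.valuation_eq_one_iff_notMem] at hΔ
  change Mp.Δ ∉ IsLocalRing.maximalIdeal ℤ_[(primesEquiv v : ℕ)] at hΔ
  rw [hMp, map_Δ, IsLocalRing.mem_maximalIdeal, PadicInt.mem_nonunits, eq_intCast,
    PadicInt.norm_int_lt_one_iff_dvd] at hΔ
  exact hΔ

end GoodReduction

end WeierstrassCurve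

namespace Literature.NumberTheory.EllipticCurves

open _root_.WeierstrassCurve Rat.HeightOneSpectrum Literature.NumberTheory.GaloisRepresentations

variable (ℓ : ℕ) [Fact ℓ.Prime] {W : WeierstrassCurve ℚ} [W.IsGloballyMinimal] [W.IsElliptic]

/-- **The ordinary line at the place's prime** (Serre 1972, §1.11, Prop. 11 and Cor.: at a
place of good ordinary reduction `τ x - x ∈ X_ℓ = 𝔽_ℓ v₀` for `τ` in the inertia group,
`x ∈ E[ℓ]`).  For `E/ℚ` minimal, `ℓ ∤ Δ_E`, `ℓ ∤ a_ℓ`, and the prime `𝔓` of `\bar ℤ` cut out by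
the place `placeOver ℓ` (`x ∈ 𝔓 ↔ x ∈ 𝒪_𝔓.nonunits`): there is `v₀ ≠ 0` in `E[ℓ]` such that
`τ • x - x ∈ 𝔽_ℓ v₀` for all `τ ∈ I_𝔓` and `x ∈ E[ℓ]`.  Assembled from the inertia-invariance
and the non-vanishing of the reduction map on `E[ℓ]` through the counting skeleton
`exists_forall_sub_mem_line_of_invariant`. [cite: Serre1972, §1.11 Prop. 11 and Cor.] -/
theorem exists_line_of_not_dvd_frobeniusTrace (hΔ : ¬ (ℓ : ℤ) ∣ minimalDiscriminantInt W)
    (hord : ¬ (ℓ : ℤ) ∣ W.frobeniusTrace ℓ) {𝔓 : Ideal (absIntegers (𝓞 ℚ) ℚ)}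
    (hmem : ∀ x : absIntegers (𝓞 ℚ) ℚ, x ∈ 𝔓 ↔ (x : AlgebraicClosure ℚ) ∈ (placeOver ℓ).nonunits) :
    letI : Module (ZMod ℓ) (geomTorsion W ℓ) := AddSubgroup.torsionBy.zmodModule
    ∃ v₀ : geomTorsion W ℓ, v₀ ≠ 0 ∧
      ∀ τ ∈ 𝔓.inertia (absoluteGaloisGroup ℚ), ∀ x : geomTorsion W ℓ,
        ∃ b : ZMod ℓ, τ • x - x = b • v₀ := by
  letI : Module (ZMod ℓ) (geomTorsion W ℓ) := AddSubgroup.torsionBy.zmodModule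
  have hp : ℓ.Prime := Fact.out
  have hℓ' : (ℓ : AlgebraicClosure ℚ) ≠ 0 := Nat.cast_ne_zero.mpr hp.ne_zero
  have hcard : Nat.card (geomTorsion W ℓ) = ℓ ^ 2 :=
    card_torsionPoints_eq_sq_holds W (AlgebraicClosure ℚ) (n := ℓ) hℓ'
  -- the reduction map on `E[ℓ]`, invariant under `I_𝔓` and nonzero
  set f : geomTorsion W ℓ →+ (reductionModPrime W ℓ).geomPoints :=
    (geomReduction hΔ).comp (geomTorsion W ℓ).subtype with hf
  set T : 𝔓.inertia (absoluteGaloisGroup ℚ) → geomTorsion W ℓ →+ geomTorsion W ℓ :=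
    fun i ↦ DistribSMul.toAddMonoidHom (geomTorsion W ℓ) (i : absoluteGaloisGroup ℚ) with hT
  have hinv : ∀ (i : 𝔓.inertia (absoluteGaloisGroup ℚ)) (x : geomTorsion W ℓ), f (T i x) = f x := by
    intro i x
    simp only [hf, hT, AddMonoidHom.coe_comp, Function.comp_apply, AddSubgroup.coe_subtype,
      DistribSMul.toAddMonoidHom_apply, AddSubgroup.torsionBy.coe_smul]
    exact geomReduction_smul_of_mem_inertia hΔ hmem i.2 (x : W.geomPoints)
  have hf0 : ∃ x : geomTorsion W ℓ, f x ≠ 0 := by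
    obtain ⟨P, hP, hred⟩ := exists_zsmul_eq_zero_geomReduction_ne_zero ℓ hΔ hord
    exact ⟨⟨P, (Submodule.mem_torsionBy_iff _ _).mpr hP⟩, hred⟩
  obtain ⟨v₀, hv₀, hline⟩ := exists_forall_sub_mem_line_of_invariant hcard f T hinv hf0
  refine ⟨v₀, hv₀, fun τ hτ x ↦ ?_⟩
  obtain ⟨b, hb⟩ := hline ⟨τ, hτ⟩ x
  exact ⟨b, by simpa only [hT, DistribSMul.toAddMonoidHom_apply] using hb⟩

/-- **The ordinary alternative of Serre's local input, at every prime above `ℓ`** (Serre 1972,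
§1.11, Cor. of Prop. 11, in the frame-free form consumed by
`serre_open_image_of_reduction_shape`).  For `E/ℚ` minimal, `ℓ ∤ Δ_E`, `ℓ ∤ a_ℓ`, `v` the
place of `ℚ` at `ℓ` and any prime `𝔏` of `\bar ℤ` above `v`: there is `v₀ ≠ 0` in `E[ℓ]` with
`τ • x - x ∈ 𝔽_ℓ v₀` for all `τ ∈ I_𝔏`, `x ∈ E[ℓ]`.  The prime `𝔏` is a `Γ_ℚ`-conjugate
`g • 𝔓` of the place's prime (`exists_smul_eq_of_mem_primesAbove_holds`), `I_{g𝔓} = g I_𝔓 g⁻¹`,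
and the line for `𝔏` is `g • (𝔽_ℓ v₀)`. [cite: Serre1972, §1.11 Prop. 11 and Cor.] -/
theorem exists_line_of_not_dvd_frobeniusTrace_of_mem_primesAbove
    (hΔ : ¬ (ℓ : ℤ) ∣ minimalDiscriminantInt W) (hord : ¬ (ℓ : ℤ) ∣ W.frobeniusTrace ℓ)
    {v : HeightOneSpectrum (𝓞 ℚ)} (hv : (primesEquiv v : ℕ) = ℓ)
    {𝔏 : Ideal (absIntegers (𝓞 ℚ) ℚ)} (h𝔏 : 𝔏 ∈ v.primesAbove) :
    letI : Module (ZMod ℓ) (geomTorsion W ℓ) := AddSubgroup.torsionBy.zmodModule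
    ∃ v₀ : geomTorsion W ℓ, v₀ ≠ 0 ∧
      ∀ τ ∈ 𝔏.inertia (absoluteGaloisGroup ℚ), ∀ x : geomTorsion W ℓ,
        ∃ b : ZMod ℓ, τ • x - x = b • v₀ := by
  letI : Module (ZMod ℓ) (geomTorsion W ℓ) := AddSubgroup.torsionBy.zmodModule
  obtain ⟨𝔓, hmem, h𝔓⟩ := exists_ideal_placeOver ℓ hv
  obtain ⟨g, hg⟩ :=
    HeightOneSpectrum.exists_smul_eq_of_mem_primesAbove_holds (K := ℚ) (v := v) h𝔓 h𝔏
  obtain ⟨v₀, hv₀, hline⟩ := exists_line_of_not_dvd_frobeniusTrace ℓ hΔ hord hmem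
  refine ⟨g • v₀, fun h0 ↦ hv₀ ((smul_eq_zero_iff_eq g).mp h0), fun τ hτ x ↦ ?_⟩
  rw [← hg] at hτ
  have hσ : g⁻¹ * τ * g ∈ 𝔓.inertia (absoluteGaloisGroup ℚ) :=
    DegreeOnePrimes.conj_mem_inertia_of_mem_inertia_smul hτ
  obtain ⟨b, hb⟩ := hline _ hσ (g⁻¹ • x)
  refine ⟨b, ?_⟩
  have key : τ • x - x = g • ((g⁻¹ * τ * g) • g⁻¹ • x - g⁻¹ • x) := by
    rw [smul_sub, smul_smul, smul_smul, show g * (g⁻¹ * τ * g) * g⁻¹ = τ by group, smul_inv_smul]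
  rw [key, hb]
  exact ZMod.map_smul (DistribSMul.toAddMonoidHom (geomTorsion W ℓ) g) b v₀

/-- **Serre's open image theorem over `ℚ` from the density fact and Prop. 12 c) at the
supersingular primes.**  Assume (hD) `WeierstrassCurve.serre_supersingular_density_zero` (for
`E/ℚ` without CM the good supersingular primes have density `0`; Serre 1968 IV-13, used in
§4.2 c)) and (hS) Serre 1972, §1.11, Prop. 12 c) over `ℚ` (`e = 1`): for `E/ℚ` minimal and a
prime `ℓ` of good **supersingular** reduction (`ℓ ∣ a_ℓ`), the image of every inertia group
`I_𝔏`, `𝔏 ∣ ℓ`, in `Aut(E[ℓ])` is cyclic of order `ℓ² - 1`.  Then for every elliptic curve `E/ℚ`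
without complex multiplication `ρ̄_{E,ℓ} : Γ_ℚ → GL₂(𝔽_ℓ)` is onto for all large primes `ℓ`
(§4.2 Théorème 2 over `K = ℚ`, the named fact `serre_open_image`).  The ordinary alternative of
the local input of `serre_open_image_of_reduction_shape` is supplied by
`exists_line_of_not_dvd_frobeniusTrace_of_mem_primesAbove`.
[cite: Serre1972, §4.2 Théorème 2; §1.11 Prop. 11–12] -/
theorem serre_open_image_of_supersingular_inertia_shape (hD : serre_supersingular_density_zero)
    (hS : ∀ (W : WeierstrassCurve ℚ) [W.IsElliptic] [W.IsGloballyMinimal] (ℓ : ℕ) [Fact ℓ.Prime],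
      W.HasGoodReductionAtPrime ℓ → (ℓ : ℤ) ∣ W.frobeniusTrace ℓ →
      ∀ v : HeightOneSpectrum (𝓞 ℚ), (primesEquiv v : ℕ) = ℓ → ∀ 𝔏 ∈ v.primesAbove,
        IsCyclic ((𝔏.inertia (absoluteGaloisGroup ℚ)).map (galoisRepTorsion W ℓ)) ∧
          Nat.card ((𝔏.inertia (absoluteGaloisGroup ℚ)).map (galoisRepTorsion W ℓ)) =
            ℓ ^ 2 - 1) :
    serre_open_image := by
  refine serre_open_image_of_reduction_shape hD fun W _ _ ℓ _ hgood v hv 𝔏 h𝔏 ↦ ?_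
  by_cases hord : (ℓ : ℤ) ∣ W.frobeniusTrace ℓ
  · exact Or.inr (hS W ℓ hgood hord v hv 𝔏 h𝔏)
  · exact Or.inl (exists_line_of_not_dvd_frobeniusTrace_of_mem_primesAbove ℓ
      (W.not_dvd_minimalDiscriminantInt_of_hasGoodReductionAtPrime' ℓ hgood) hord hv h𝔏)

end Literature.NumberTheory.EllipticCurves
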